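import Literature.Probability.Percolation.CutPointAltArms
import Literature.Probability.Percolation.ArmSeparationFourArm
import Literature.Probability.Percolation.ArmSeparationRotate
import HarnessLib

/-!
# Four alternating arms landed on prescribed sides of the hexagon, and why they are alternating in cluster form

Topic `Literature/Probability/Percolation`; family `crit-perc`. Serves the discharge of the named
facts `Literature.Probability.Percolation.Werner2009_lemma63` (W. Werner, *Lectures on
two-dimensional critical percolation*, PCMI 2009, Lecture 6, Lemma 6.3) and
`Werner2009_fourArm_quasiMult` (Cor. 6.2) through Werner's ALTERNATING `π̂_p`
(`altFourArmProbAt`, `AltFourArm.lean`). One DEFINITION with its elementary API, no named fact.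

Kesten's gluing of well-separated arms (Nolin 2008, Prop. 12 [arXiv 0711.4948: Prop. 11]; the
tree's `sepFourArm_glue_subset`, `ArmSeparationFourArm.lean`) produces four arms whose outer
extremities lie on prescribed SIDES of the hexagon `∂Λ_N` — open arms on the sides `0` and `3`,
closed arms on the sides `1` and `4` (side `i` = `ρ^i` of the right side `{x₀ = N, -N ≤ x₁ ≤ 0}`,
`ρ` the rotation by `60°`) — and the tree records the result only as the ORDER-FREE event
`armEvent ![T,F,T,F]`. For the alternating calculus (quasi-multiplicativity of `π̂^alt`, the
pivotal analysis of Lemma 6.3) one needs that such landed arms realise the alternating event in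
the CLUSTER FORM of `altFourArm` (the two open arms not joined by an open path of the annulus, the
two closed arms not by a closed one). This file defines the landed event and proves that
inclusion from the Hex lemma alone:

* `hexSide R i` — side `i` of `∂Λ_R` (closed, corners included), `hexSide_subset_triSphere`, the
  coordinates of the sides `0, 1, 3, 4`, and `mem_hexSide_zero_of_adj_cone` (a site of `∂Λ_R`
  adjacent to a site of the open cone over side `0` beyond `Λ_R` lies on side `0`: how a glued arm
  is seen to land on its side);
* `exists_adj_triNorm_eq_sub_one`, `pathIn_triBall_zero`, `pathIn_triBall` — every site `z ≠ 0`
  has a neighbour of graph norm `|z|_𝕋 - 1`; the hexagons `Λ_m` are connected (the "hole" of an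
  annulus can be crossed);
* **`hexSides_interleaved_false`** — in the hexagon `Λ_R`, a black path from side `0` to side `3`
  and a white path from side `1` to side `4` cannot coexist: the reflection
  `(x₀, x₁) ↦ (x₀, -x₀ - x₁)` of `𝕋` (`= triSwapIso ∘ ρ²`) fixes the sides `0, 3 ⊆ {x₀ = ±R}` and
  maps the sides `1, 4` into `{x₁ = ∓R}`, where this is the exclusivity half of the Hex lemma for
  the box `[-R, R]² ⊇ Λ_R` (`tri_hex_excl_triSqBox`, Bollobás–Riordan 2006, Ch. 5, Lemma 7);
* `landedAltFourArm r R` — **four pairwise disjoint arms across `Λ_R ∖ Λ_r`, open ones landed on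
  the sides `0` and `3`, closed ones on the sides `1` and `4`** (Nolin 2008, §4.2, Def. 8: the
  event `Ā^{·/I}_{4,BWBW}(r, R)` with the landing areas `I` = whole sides and no free spaces);
  `landedAltFourArm_subset_armEvent`, the constructor `mem_landedAltFourArm_of_pathIn` from four
  disjoint coloured site sets, locality `determinedBy_landedAltFourArm`, measurability;
* **`landedAltFourArm_subset_altFourArm`** (`1 ≤ r ≤ R`) — landed alternating arms are alternating
  in cluster form: an open path of the annulus joining the two open arms would give, with them, a
  black path from side `0` to side `3`, while the closed arms continued through the hole `Λ_{r-1}`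
  (painted white) give a white path from side `1` to side `4` — impossible by
  `hexSides_interleaved_false`; symmetrically for a closed joining path, with the hole painted black.

## References

* P. Nolin, Near-critical percolation in two dimensions, *Electron. J. Probab.* 13 (2008)
  1562–1623, §4.1 (`A_{j,σ}`), §4.2 Def. 8 (`Ā^{I/I'}`), §4.3 Prop. 12 (arXiv 0711.4948: Def. 7,
  Prop. 11) [Nolin2008].
* W. Werner, *Lectures on two-dimensional critical percolation*, IAS/Park City Math. Ser. 16
  (2009), Lecture 6, §4 (`π̂_p(r₁, r₂)`, Prop. 6.1, Cor. 6.2) [WernerPCMI2009].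
* H. Kesten, Scaling relations for 2D-percolation, *Comm. Math. Phys.* 109 (1987), §1 (1.12),
  Lemmas 4–6 [KestenScalingCMP1987].
* B. Bollobás, O. Riordan, *Percolation*, CUP (2006), Ch. 5, Lemma 7 (Hex lemma) [BollobasRiordan2006].

Tree: `altFourArm`, `triAnn`, `mem_triAnn` (`AltFourArm.lean`), `armEvent`, `IsColouredPath`
(`ArmEvents.lean`), `mem_triAnnulus_of_arm` (`ArmEventsProofs.lean`), `triSqBox`,
`mem_triSqBox_of_triNorm_le`, `tri_hex_excl_triSqBox`, `triNorm_transposeIso` (`CutPointArms.lean`),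
`triSwapIso`, `triSwapIso_apply` (`TriHexLemma.lean`), `triRotIsoPow`, `triNorm_rot`,
`rot_apply_formula` (`TriAnnulusCircuit.lean`, `ArmSeparationRotate.lean`), `triNorm_le_iff_lin`,
`le_triNorm_iff_lin`, `triNorm_eq_apply_zero` (`ArmEventsAPriori.lean`),
`triNorm_le_triNorm_add_one_of_adj` (`ArmEventsProofs.lean`), `triGraph_adj_iff_coord`,
`PathIn` API (`SitePaths.lean`), `PathIn.of_walk_mem_support` (`OneArmLSW.lean`), `pathIn_map_iso`
(`TriRSWChaining.lean`), `DeterminedBy`. Mathlib: `SimpleGraph.Walk.toPath`, `RelIso.trans`.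
-/

noncomputable section

open Set

namespace Literature.Probability.Percolation

open LatticeModels

/-! ### The sides of the hexagon `∂Λ_R` -/

/-- The right side of the hexagon `∂Λ_R`, corners included: `{x₀ = R, -R ≤ x₁ ≤ 0}`. [cite: Nolin2008, §4.2 (the sides of ∂S_N as landing areas)] -/
def hexSide₀ (R : ℕ) : Set (Site 2) := {z | z 0 = R ∧ -(R : ℤ) ≤ z 1 ∧ z 1 ≤ 0}

/-- **Side `i` of the hexagon `∂Λ_R`** (corners included): the image of the right side under the
rotation `ρ^i` (`ρ` = rotation by `60°`, `triRotIsoPow`); sides `0, 3` are `{x₀ = ±R}`, sides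
`1, 4` are `{x₀ + x₁ = ±R}`, sides `2, 5` are `{x₁ = ±R}`. (Unrelated to `TriHexagon.hexSide`, the
sides of the hexagonal domains `H_k` of `TriHexagon.lean`.) [cite: Nolin2008, §4.2 (the sides of ∂S_N as landing areas)] -/
def hexSide (R i : ℕ) : Set (Site 2) := triRotIsoPow i '' hexSide₀ R

/-- Membership in a side, unfolded. [folklore] -/
theorem mem_hexSide_iff {R i : ℕ} {z : Site 2} :
    z ∈ hexSide R i ↔ ∃ s : Site 2, (s 0 = R ∧ -(R : ℤ) ≤ s 1 ∧ s 1 ≤ 0) ∧ triRotIsoPow i s = z := by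
  simp only [hexSide, hexSide₀, mem_image, mem_setOf_eq]

/-- A site of the right side has graph norm `R`. [folklore] -/
theorem triNorm_of_mem_hexSide₀ {R : ℕ} {z : Site 2} (hz : z ∈ hexSide₀ R) : triNorm z = R := by
  obtain ⟨h0, h1, h2⟩ := hz
  rw [triNorm_eq_apply_zero h2 (by omega), h0]

/-- A site of a side has graph norm `R`. [folklore] -/
theorem triNorm_of_mem_hexSide {R i : ℕ} {z : Site 2} (hz : z ∈ hexSide R i) : triNorm z = R := by
  obtain ⟨s, hs, rfl⟩ := mem_hexSide_iff.1 hz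
  rw [triNorm_rot]
  exact triNorm_of_mem_hexSide₀ hs

/-- The sides lie on the sphere `∂Λ_R`. [folklore] -/
theorem hexSide_subset_triSphere (R i : ℕ) : hexSide R i ⊆ (↑(triSphere R) : Set (Site 2)) :=
  fun _ hz => Finset.mem_coe.2 (mem_triSphere_iff.2 (triNorm_of_mem_hexSide hz))

/-- Coordinates of side `0`: `x₀ = R`, `-R ≤ x₁ ≤ 0`. [folklore] -/
theorem mem_hexSide_zero {R : ℕ} {z : Site 2} :
    z ∈ hexSide R 0 ↔ z 0 = R ∧ -(R : ℤ) ≤ z 1 ∧ z 1 ≤ 0 := by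
  rw [mem_hexSide_iff]
  constructor
  · rintro ⟨s, hs, rfl⟩
    simpa only [triRotIsoPow_zero_apply] using hs
  · intro h
    exact ⟨z, h, triRotIsoPow_zero_apply z⟩

/-- Coordinates of side `3`: `x₀ = -R` (and `0 ≤ x₁ ≤ R`). [folklore] -/
theorem coord_of_mem_hexSide_three {R : ℕ} {z : Site 2} (hz : z ∈ hexSide R 3) :
    z 0 = -(R : ℤ) ∧ 0 ≤ z 1 ∧ z 1 ≤ R := by
  obtain ⟨s, ⟨h0, h1, h2⟩, rfl⟩ := mem_hexSide_iff.1 hz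
  obtain ⟨-, -, -, -, -, -, r30, r31, -⟩ := rot_apply_formula s
  rw [r30, r31]; omega

/-- Coordinates of side `1`: `x₀ + x₁ = R` (and `0 ≤ x₀ ≤ R`). [folklore] -/
theorem coord_of_mem_hexSide_one {R : ℕ} {z : Site 2} (hz : z ∈ hexSide R 1) :
    z 0 + z 1 = R ∧ 0 ≤ z 0 ∧ z 0 ≤ R := by
  obtain ⟨s, ⟨h0, h1, h2⟩, rfl⟩ := mem_hexSide_iff.1 hz
  obtain ⟨-, -, r10, r11, -⟩ := rot_apply_formula s
  rw [r10, r11]; omega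

/-- Coordinates of side `4`: `x₀ + x₁ = -R` (and `-R ≤ x₀ ≤ 0`). [folklore] -/
theorem coord_of_mem_hexSide_four {R : ℕ} {z : Site 2} (hz : z ∈ hexSide R 4) :
    z 0 + z 1 = -(R : ℤ) ∧ -(R : ℤ) ≤ z 0 ∧ z 0 ≤ 0 := by
  obtain ⟨s, ⟨h0, h1, h2⟩, rfl⟩ := mem_hexSide_iff.1 hz
  obtain ⟨-, -, -, -, -, -, -, -, r40, r41, -⟩ := rot_apply_formula s
  rw [r40, r41]; omega

/-- Sides are carried to sides by the rotation: `ρ^a(side i) = side (i + a)`. [folklore] -/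
theorem image_rot_hexSide (R i a : ℕ) : triRotIsoPow a '' hexSide R i = hexSide R (i + a) := by
  ext z
  simp only [hexSide, mem_image]
  constructor
  · rintro ⟨w, ⟨s, hs, rfl⟩, rfl⟩
    exact ⟨s, hs, triRotIsoPow_add_apply i a s⟩
  · rintro ⟨s, hs, rfl⟩
    exact ⟨triRotIsoPow i s, ⟨s, hs, rfl⟩, (triRotIsoPow_add_apply i a s).symm⟩

/-- **How a glued arm is seen to land on side `0`.** A site `y` of `∂Λ_R` adjacent to a site `b`
of graph norm `R + 1` lying in the open cone over side `0` (`0 < b₀`, `b₁ < 0`, `0 < b₀ + b₁`)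
lies on side `0`. [folklore] -/
theorem mem_hexSide_zero_of_adj_cone {R : ℕ} {y b : Site 2} (hy : triNorm y = R)
    (hb : triNorm b = (R : ℤ) + 1) (hc : 0 < b 0 ∧ b 1 < 0 ∧ 0 < b 0 + b 1) (hadj : triGraph.Adj y b) :
    y ∈ hexSide R 0 := by
  have hb0 : b 0 = (R : ℤ) + 1 := by rw [← hb, triNorm_eq_apply_zero hc.2.1.le hc.2.2.le]
  have hyle := triNorm_le_iff_lin.1 hy.le
  rw [mem_hexSide_zero]
  rcases (triGraph_adj_iff_coord y b).1 hadj with h | h | h | h | h | h <;> omega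

/-! ### Inward steps and the connectedness of the hexagons -/

/-- **Every site `z ≠ 0` has a neighbour of graph norm `|z|_𝕋 - 1`** (case analysis over the six
closed sectors of the hexagon `∂Λ_{|z|}` and their corner rays). [folklore] -/
theorem exists_adj_triNorm_eq_sub_one {z : Site 2} (hz : z ≠ 0) :
    ∃ z' : Site 2, triGraph.Adj z z' ∧ triNorm z' = triNorm z - 1 := by
  set n := triNorm z with hn
  have hle := triNorm_le_iff_lin.1 (le_refl n)
  obtain ⟨h1, h2, h3, h4, h5, h6⟩ := hle
  have hge := le_triNorm_iff_lin.1 (le_refl n)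
  have hn1 : 1 ≤ n := by
    by_contra hlt
    push Not at hlt
    apply hz
    ext i; fin_cases i <;> simp <;> omega
  -- a candidate neighbour of norm at most `n - 1` has norm exactly `n - 1`
  have mk : ∀ z' : Site 2, triGraph.Adj z z' → triNorm z' ≤ n - 1 →
      ∃ z' : Site 2, triGraph.Adj z z' ∧ triNorm z' = triNorm z - 1 := by
    intro z' ha hb
    refine ⟨z', ha, le_antisymm (by rw [← hn]; exact hb) ?_⟩
    have := triNorm_le_triNorm_add_one_of_adj' ha
    rw [← hn] at this; omega
  have adj : ∀ a b : ℤ, ((a = z 0 + 1 ∧ b = z 1) ∨ (z 0 = a + 1 ∧ b = z 1) ∨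
      (b = z 1 + 1 ∧ a = z 0) ∨ (z 1 = b + 1 ∧ a = z 0) ∨
      (a = z 0 + 1 ∧ z 1 = b + 1) ∨ (z 0 = a + 1 ∧ b = z 1 + 1)) → triGraph.Adj z ![a, b] := by
    intro a b h
    rw [triGraph_adj_iff_coord]
    simpa only [Matrix.cons_val_zero, Matrix.cons_val_one, Matrix.head_cons] using h
  have nle : ∀ a b : ℤ, (a ≤ n - 1 ∧ -a ≤ n - 1 ∧ b ≤ n - 1 ∧ -b ≤ n - 1 ∧ a + b ≤ n - 1 ∧ -(a + b) ≤ n - 1) →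
      triNorm ![a, b] ≤ n - 1 := by
    intro a b h
    rw [triNorm_le_iff_lin]
    simpa only [Matrix.cons_val_zero, Matrix.cons_val_one, Matrix.head_cons] using h
  rcases hge with h | h | h | h | h | h
  · -- `n = z₀`
    by_cases hc : -n < z 1
    · exact mk _ (adj (z 0 - 1) (z 1) (by omega)) (nle _ _ (by omega))
    · exact mk _ (adj (z 0 - 1) (z 1 + 1) (by omega)) (nle _ _ (by omega))
  · -- `n = -z₀`
    by_cases hc : z 1 < n
    · exact mk _ (adj (z 0 + 1) (z 1) (by omega)) (nle _ _ (by omega))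
    · exact mk _ (adj (z 0 + 1) (z 1 - 1) (by omega)) (nle _ _ (by omega))
  · -- `n = z₁`
    by_cases hc : -n < z 0
    · exact mk _ (adj (z 0) (z 1 - 1) (by omega)) (nle _ _ (by omega))
    · exact mk _ (adj (z 0 + 1) (z 1 - 1) (by omega)) (nle _ _ (by omega))
  · -- `n = -z₁`
    by_cases hc : z 0 < n
    · exact mk _ (adj (z 0) (z 1 + 1) (by omega)) (nle _ _ (by omega))
    · exact mk _ (adj (z 0 - 1) (z 1 + 1) (by omega)) (nle _ _ (by omega))
  · -- `n = z₀ + z₁`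
    by_cases hc : 1 ≤ z 0
    · exact mk _ (adj (z 0 - 1) (z 1) (by omega)) (nle _ _ (by omega))
    · exact mk _ (adj (z 0) (z 1 - 1) (by omega)) (nle _ _ (by omega))
  · -- `n = -(z₀ + z₁)`
    by_cases hc : z 0 ≤ -1
    · exact mk _ (adj (z 0 + 1) (z 1) (by omega)) (nle _ _ (by omega))
    · exact mk _ (adj (z 0) (z 1 + 1) (by omega)) (nle _ _ (by omega))

/-- **Every site of `Λ_m` is joined to the origin inside `Λ_m`** (iterate the inward step). [folklore] -/
theorem pathIn_triBall_zero {m : ℕ} {z : Site 2} (hz : triNorm z ≤ m) :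
    PathIn triGraph (↑(triBall m) : Set (Site 2)) z 0 := by
  -- induction on the norm
  suffices H : ∀ k : ℕ, ∀ z : Site 2, triNorm z ≤ m → triNorm z ≤ k →
      PathIn triGraph (↑(triBall m) : Set (Site 2)) z 0 from
    H m z hz hz
  intro k
  induction k with
  | zero =>
    intro z hzm hz0
    have hz00 : z = 0 := by
      have h := triNorm_le_iff_lin.1 hz0
      ext i; fin_cases i <;> simp <;> omega
    subst hz00
    exact PathIn.refl (Finset.mem_coe.2 (mem_triBall_iff.2 (by simp)))
  | succ k ih =>
    intro z hzm hzk
    by_cases h0 : z = 0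
    · subst h0
      exact PathIn.refl (Finset.mem_coe.2 (mem_triBall_iff.2 (by simp)))
    · obtain ⟨z', hadj, hn'⟩ := exists_adj_triNorm_eq_sub_one h0
      have hz'm : triNorm z' ≤ m := by omega
      have hzA : z ∈ (↑(triBall m) : Set (Site 2)) := Finset.mem_coe.2 (mem_triBall_iff.2 hzm)
      have hz'A : z' ∈ (↑(triBall m) : Set (Site 2)) := Finset.mem_coe.2 (mem_triBall_iff.2 hz'm)
      exact (PathIn.of_adj hzA hz'A hadj).trans (ih z' hz'm (by push_cast at hzk ⊢; omega))

/-- **The hexagons are connected**: any two sites of `Λ_m` are joined inside `Λ_m`. [folklore] -/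
theorem pathIn_triBall {m : ℕ} {z z' : Site 2} (hz : triNorm z ≤ m) (hz' : triNorm z' ≤ m) :
    PathIn triGraph (↑(triBall m) : Set (Site 2)) z z' :=
  (pathIn_triBall_zero hz).trans (pathIn_triBall_zero hz').symm

/-- A site of `∂Λ_r`, `r ≥ 1`, has a neighbour in the hole `Λ_{r-1}`. [folklore] -/
theorem exists_adj_mem_triBall_sub_one {r : ℕ} (hr : 1 ≤ r) {x : Site 2} (hx : triNorm x = r) :
    ∃ h : Site 2, triGraph.Adj x h ∧ triNorm h ≤ (r - 1 : ℕ) := by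
  have hx0 : x ≠ 0 := by
    rintro rfl
    rw [triNorm_zero] at hx
    omega
  obtain ⟨h, hadj, hn⟩ := exists_adj_triNorm_eq_sub_one hx0
  refine ⟨h, hadj, ?_⟩
  rw [hn, hx]
  push_cast [Nat.cast_sub hr]
  omega

/-! ### Interleaved crossings of the hexagon do not coexist -/

/-- The reflection `(x₀, x₁) ↦ (x₀, -x₀ - x₁)` of `𝕋`, as the automorphism `triSwapIso ∘ ρ²`. [folklore] -/
def hexReflIso : triGraph ≃g triGraph := (triRotIsoPow 2).trans triSwapIso

/-- First coordinate of the reflection. [folklore] -/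
theorem hexReflIso_apply_zero (z : Site 2) : hexReflIso z 0 = z 0 := by
  obtain ⟨-, -, -, -, r20, r21, -⟩ := rot_apply_formula z
  show transposeIso (triRotIsoPow 2 z) 0 = z 0
  rw [transposeIso_apply_zero, r21]

/-- Second coordinate of the reflection. [folklore] -/
theorem hexReflIso_apply_one (z : Site 2) : hexReflIso z 1 = -(z 0 + z 1) := by
  obtain ⟨-, -, -, -, r20, r21, -⟩ := rot_apply_formula z
  show transposeIso (triRotIsoPow 2 z) 1 = -(z 0 + z 1)
  rw [transposeIso_apply_one, r20]

/-- The reflection preserves the graph norm. [folklore] -/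
theorem triNorm_hexReflIso (z : Site 2) : triNorm (hexReflIso z) = triNorm z := by
  show triNorm (transposeIso (triRotIsoPow 2 z)) = triNorm z
  rw [triNorm_transposeIso, triNorm_rot]

/-- **Interleaved crossings of the hexagon do not coexist** (Bollobás–Riordan 2006, Ch. 5,
Lemma 7, exclusivity, for the hexagon `Λ_R` and the side pairs `(0, 3)`, `(1, 4)`): there are not
simultaneously a path of `Λ_R ∩ B` from side `0` to side `3` and a path of `Λ_R ∖ B` from side `1`
to side `4`. Proof: the reflection `(x₀, x₁) ↦ (x₀, -x₀ - x₁)` maps `Λ_R` to itself, the sides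
`0, 3` into `{x₀ = ±R}` and the sides `1, 4` into `{x₁ = ∓R}`, and `Λ_R ⊆ [-R, R]²`, where a
black left–right path and a white bottom–top path exclude each other (`tri_hex_excl_triSqBox`). [cite: BollobasRiordan2006, Ch. 5 Lemma 7] -/
theorem hexSides_interleaved_false {R : ℕ} {B : Set (Site 2)} {x y u w : Site 2}
    (hx : x ∈ hexSide R 0) (hy : y ∈ hexSide R 3) (hu : u ∈ hexSide R 1) (hw : w ∈ hexSide R 4)
    (hp : PathIn triGraph ((↑(triBall R) : Set (Site 2)) ∩ B) x y)
    (hq : PathIn triGraph ((↑(triBall R) : Set (Site 2)) \ B) u w) : False := by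
  set φ := hexReflIso with hφ
  have hp' := pathIn_map_iso φ hp.symm
  have hq' := pathIn_map_iso φ hq
  -- images of the two sets
  have hB : φ '' ((↑(triBall R) : Set (Site 2)) ∩ B) ⊆ triSqBox R ∩ (φ '' B) := by
    rintro z ⟨a, ⟨haR, haB⟩, rfl⟩
    refine ⟨mem_triSqBox_of_triNorm_le ?_, a, haB, rfl⟩
    rw [triNorm_hexReflIso]
    exact mem_triBall_iff.1 (Finset.mem_coe.1 haR)
  have hW : φ '' ((↑(triBall R) : Set (Site 2)) \ B) ⊆ triSqBox R ∩ (φ '' B)ᶜ := by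
    rintro z ⟨a, ⟨haR, haB⟩, rfl⟩
    refine ⟨mem_triSqBox_of_triNorm_le ?_, ?_⟩
    · rw [triNorm_hexReflIso]
      exact mem_triBall_iff.1 (Finset.mem_coe.1 haR)
    · rintro ⟨b, hbB, hba⟩
      exact haB (φ.injective hba ▸ hbB)
  -- coordinates of the four endpoints
  have hx0 : φ x 0 = R := by rw [hexReflIso_apply_zero]; exact (mem_hexSide_zero.1 hx).1
  have hy0 : φ y 0 = -(R : ℤ) := by rw [hexReflIso_apply_zero]; exact (coord_of_mem_hexSide_three hy).1
  have hu1 : φ u 1 = -(R : ℤ) := by rw [hexReflIso_apply_one, (coord_of_mem_hexSide_one hu).1]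
  have hw1 : φ w 1 = (R : ℤ) := by rw [hexReflIso_apply_one, (coord_of_mem_hexSide_four hw).1]; ring
  exact tri_hex_excl_triSqBox R (φ '' B) hy0 hx0 (hp'.mono hB) hu1 hw1 (hq'.mono hW)

/-! ### The landed alternating event -/

/-- The sides on which the four arms land: open arms on the sides `0, 3`, closed arms on the
sides `1, 4` (the landing areas of `sepFourArm`). [cite: Nolin2008, §4.2 Def. 8 (landing areas I)] -/
def landSide : Fin 4 → ℕ := ![0, 1, 3, 4]

/-- **Four alternating arms landed on the sides `0, 1, 3, 4` of `∂Λ_R`.** Four pairwise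
vertex-disjoint self-avoiding arms `w 0, …, w 3` across `Λ_R ∖ Λ_r`, of colours open, closed,
open, closed, the `j`-th from a site of `∂Λ_r` to a site of side `landSide j` of `∂Λ_R` (open arms
on the opposite sides `0, 3`, closed arms on the opposite sides `1, 4`): Nolin's event
`Ā^{·/I}_{4,σ}(r, R)`, `σ = BWBW`, with the landing areas `I` = the four whole sides and no free
spaces; the form in which Kesten's gluing delivers four arms. [cite: Nolin2008, §4.2 Def. 8 and §4.3 Prop. 12 (arXiv 0711.4948: Def. 7, Prop. 11)] -/
def landedAltFourArm (r R : ℕ) : Set (SiteConfig (Site 2)) :=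
  {ω | ∃ (x y : Fin 4 → Site 2) (w : ∀ j, triGraph.Walk (x j) (y j)),
    (∀ j, x j ∈ triSphere r ∧ y j ∈ hexSide R (landSide j) ∧ (w j).IsPath ∧
      (∀ v ∈ (w j).support, v ∈ (↑(triBall R) : Set (Site 2)) \ ↑(triBall r) ∨ v ∈ triSphere r) ∧
      IsColouredPath ω (![true, false, true, false] j) (w j)) ∧
    (Pairwise fun i j => Disjoint (w i).support.toFinset (w j).support.toFinset)}

/-- Landed arms are arms: `landedAltFourArm r R ⊆ armEvent ![T,F,T,F] r R`. [cite: Nolin2008, §4.2 (Ā ⊆ A)] -/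
theorem landedAltFourArm_subset_armEvent (r R : ℕ) :
    landedAltFourArm r R ⊆ armEvent ![true, false, true, false] r R := by
  rintro ω ⟨x, y, w, hw, hdisj⟩
  exact ⟨x, y, w, fun j => ⟨(hw j).1, Finset.mem_coe.1 (hexSide_subset_triSphere R _ (hw j).2.1),
    (hw j).2.2⟩, hdisj⟩

/-- **`landedAltFourArm` from four coloured site sets** (the analogue of `mem_altFourArm_of_pathIn`
and `mem_armEvent_of_disjointPaths`): four pairwise disjoint site sets of colours
open/closed/open/closed inside the annulus `{r ≤ |·| ≤ R}`, the `j`-th containing a path from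
`∂Λ_r` to side `landSide j` of `∂Λ_R`, realise the landed event (loop-erase inside each set). [cite: Nolin2008, §4.2 Def. 8 (arXiv 0711.4948: Def. 7)] -/
theorem mem_landedAltFourArm_of_pathIn {r R : ℕ} {ω : SiteConfig (Site 2)}
    (T : Fin 4 → Set (Site 2)) (hT : Pairwise fun i j => Disjoint (T i) (T j))
    (hcol : ∀ i, ∀ z ∈ T i, (z ∈ ω ↔ (![true, false, true, false] : Fin 4 → Bool) i = true))
    (hann : ∀ i, ∀ z ∈ T i, (r : ℤ) ≤ triNorm z ∧ triNorm z ≤ R)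
    (hp : ∀ i, ∃ x ∈ triSphere r, ∃ y ∈ hexSide R (landSide i), PathIn triGraph (T i) x y) :
    ω ∈ landedAltFourArm r R := by
  classical
  choose x hx y hy hpath using hp
  have hw : ∀ i, ∃ W : triGraph.Walk (x i) (y i), ∀ z ∈ W.support, z ∈ T i :=
    fun i => (hpath i).exists_walk
  choose W hW using hw
  have hsub : ∀ i, ∀ z ∈ ((W i).toPath : triGraph.Walk (x i) (y i)).support, z ∈ T i :=
    fun i z hz => hW i z (SimpleGraph.Walk.support_toPath_subset_support (W i) hz)
  refine ⟨x, y, fun i => ((W i).toPath : triGraph.Walk (x i) (y i)), fun i => ?_, ?_⟩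
  · refine ⟨hx i, hy i, (W i).toPath.2, fun z hz => ?_, fun z hz => ?_⟩
    · obtain ⟨h1, h2⟩ := hann i z (hsub i z hz)
      rcases eq_or_lt_of_le h1 with h1 | h1
      · right; rw [mem_triSphere_iff, ← h1]
      · left
        simp only [mem_sdiff, Finset.mem_coe, mem_triBall_iff, not_le]
        exact ⟨h2, h1⟩
    · have := hcol i z (hsub i z hz)
      simpa using this
  · intro i j hij
    rw [Finset.disjoint_left]
    intro z hzi hzj
    rw [List.mem_toFinset] at hzi hzj
    exact Set.disjoint_left.1 (hT hij) (hsub i z hzi) (hsub j z hzj)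

/-! ### Locality -/

/-- **The landed event is determined by the sites of the annulus** `triAnnulus r R`. [cite: Nolin2008, §4.2] -/
theorem landedAltFourArm_determined {r R : ℕ} (hrR : r ≤ R) (ω ω' : SiteConfig (Site 2))
    (h : ∀ v ∈ triAnnulus r R, (v ∈ ω ↔ v ∈ ω')) :
    ω ∈ landedAltFourArm r R ↔ ω' ∈ landedAltFourArm r R := by
  constructor
  · rintro ⟨x, y, w, hw, hdisj⟩
    refine ⟨x, y, w, fun j => ?_, hdisj⟩
    obtain ⟨hx, hy, hpath, hsupp, hcol⟩ := hw j
    exact ⟨hx, hy, hpath, hsupp, fun v hv =>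
      (h v (mem_triAnnulus_of_arm hrR (hsupp v hv))).symm.trans (hcol v hv)⟩
  · rintro ⟨x, y, w, hw, hdisj⟩
    refine ⟨x, y, w, fun j => ?_, hdisj⟩
    obtain ⟨hx, hy, hpath, hsupp, hcol⟩ := hw j
    exact ⟨hx, hy, hpath, hsupp, fun v hv =>
      (h v (mem_triAnnulus_of_arm hrR (hsupp v hv))).trans (hcol v hv)⟩

/-- `DeterminedBy` form of `landedAltFourArm_determined`. [cite: Nolin2008, §4.2] -/
theorem determinedBy_landedAltFourArm {r R : ℕ} (hrR : r ≤ R) :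
    DeterminedBy (landedAltFourArm r R) ↑(triAnnulus r R) := by
  rw [determinedBy_iff]
  intro ω ω' h
  refine landedAltFourArm_determined hrR ω ω' fun v hv => ?_
  have hv' : v ∈ (↑(triAnnulus r R) : Set (Site 2)) := Finset.mem_coe.2 hv
  have key := Set.ext_iff.1 h v
  exact ⟨fun hω => (key.1 ⟨hω, hv'⟩).1, fun hω' => (key.2 ⟨hω', hv'⟩).1⟩

/-- The landed event is measurable. [cite: Nolin2008, §4.2] -/
theorem measurableSet_landedAltFourArm {r R : ℕ} (hrR : r ≤ R) :
    MeasurableSet (landedAltFourArm r R) :=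
  (determinedBy_landedAltFourArm hrR).measurableSet_of_finset

/-! ### Landed alternating arms are alternating in cluster form -/

/-- The sites of an arm of the annulus lie in `triAnn r R` (`r ≤ R`). [folklore] -/
theorem mem_triAnn_of_support {r R : ℕ} (hrR : r ≤ R) {v : Site 2}
    (hv : v ∈ (↑(triBall R) : Set (Site 2)) \ ↑(triBall r) ∨ v ∈ triSphere r) : v ∈ triAnn r R := by
  have := mem_triAnnulus.1 (mem_triAnnulus_of_arm hrR hv)
  exact mem_triAnn.2 this

/-- **No black path from side `0` to side `3` when closed arms run from the hole to the sides `1`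
and `4`.** If `B` avoids the hole `Λ_{r-1}` (`1 ≤ r ≤ R`) and there are paths of `Λ_R ∖ B` from
sites of `∂Λ_r` to side `1` and to side `4`, then no path of `Λ_R ∩ B` joins side `0` to side `3`:
continue the two white paths through the hole (`pathIn_triBall`) into one white path from side `1`
to side `4` and apply `hexSides_interleaved_false`. [cite: BollobasRiordan2006, Ch. 5 Lemma 7] [cite: Nolin2008, §4.1 (BWBW ≠ BBWW)] -/
theorem not_pathIn_sides_zero_three {r R : ℕ} (hr : 1 ≤ r) (hrR : r ≤ R) {B : Set (Site 2)}
    (hB : ∀ z ∈ B, (r : ℤ) ≤ triNorm z) {x₁ y₁ x₃ y₃ : Site 2} (hx₁ : triNorm x₁ = r)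
    (hy₁ : y₁ ∈ hexSide R 1) (hx₃ : triNorm x₃ = r) (hy₃ : y₃ ∈ hexSide R 4)
    (q₁ : PathIn triGraph ((↑(triBall R) : Set (Site 2)) \ B) x₁ y₁)
    (q₃ : PathIn triGraph ((↑(triBall R) : Set (Site 2)) \ B) x₃ y₃)
    {a b : Site 2} (ha : a ∈ hexSide R 0) (hb : b ∈ hexSide R 3)
    (p : PathIn triGraph ((↑(triBall R) : Set (Site 2)) ∩ B) a b) : False := by
  -- through the hole
  obtain ⟨h₁, hadj₁, hh₁⟩ := exists_adj_mem_triBall_sub_one hr hx₁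
  obtain ⟨h₃, hadj₃, hh₃⟩ := exists_adj_mem_triBall_sub_one hr hx₃
  have hhole : (↑(triBall (r - 1)) : Set (Site 2)) ⊆ (↑(triBall R) : Set (Site 2)) \ B := by
    intro z hz
    have hz' := mem_triBall_iff.1 (Finset.mem_coe.1 hz)
    push_cast [Nat.cast_sub hr] at hz'
    have hrR' : (r : ℤ) ≤ R := by exact_mod_cast hrR
    refine ⟨Finset.mem_coe.2 (mem_triBall_iff.2 (by omega)), fun hzB => ?_⟩
    have := hB z hzB; omega
  have hmid : PathIn triGraph ((↑(triBall R) : Set (Site 2)) \ B) h₁ h₃ :=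
    (pathIn_triBall hh₁ hh₃).mono hhole
  have hq : PathIn triGraph ((↑(triBall R) : Set (Site 2)) \ B) y₁ y₃ :=
    ((q₁.symm.tail hadj₁ hmid.left_mem).trans hmid).trans
      ((PathIn.of_adj hmid.right_mem q₃.left_mem hadj₃.symm).trans q₃)
  exact hexSides_interleaved_false ha hb hy₁ hy₃ p hq

/-- **Landed alternating arms are alternating in cluster form** (`1 ≤ r ≤ R`): the two open arms
of `landedAltFourArm r R` are not joined by an open path of the annulus `{r ≤ |·| ≤ R}`, and the
two closed arms are not joined by a closed path of it, so that `landedAltFourArm r R ⊆ altFourArm r R`.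
An open joining path would give, with the open arms, a black path of `Λ_R` from side `0` to side
`3`, against the white path side `1` → closed arm → hole `Λ_{r-1}` → closed arm → side `4`
(`not_pathIn_sides_zero_three` with `B` = the open sites of the annulus); a closed joining path is
excluded in the same way with the hole painted black (Nolin 2008, §4.1: the cyclic order of arms
landed on the sides `0, 1, 3, 4` is `BWBW`). [cite: Nolin2008, §4.1–4.2 (arXiv 0711.4948, §4.1, Def. 7)] [cite: BollobasRiordan2006, Ch. 5 Lemma 7] -/
theorem landedAltFourArm_subset_altFourArm {r R : ℕ} (hr : 1 ≤ r) (hrR : r ≤ R) :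
    landedAltFourArm r R ⊆ altFourArm r R := by
  classical
  rintro ω ⟨x, y, w, hw, hdisj⟩
  have hxn : ∀ j, triNorm (x j) = r := fun j => mem_triSphere_iff.1 (hw j).1
  have hsuppAnn : ∀ j, ∀ v ∈ (w j).support, v ∈ triAnn r R :=
    fun j v hv => mem_triAnn_of_support hrR ((hw j).2.2.2.1 v hv)
  have hcolT : ∀ v ∈ (w 0).support, v ∈ ω := fun v hv => by simpa using (hw 0).2.2.2.2 v hv
  have hcolT' : ∀ v ∈ (w 2).support, v ∈ ω := fun v hv => by simpa using (hw 2).2.2.2.2 v hv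
  have hcolF : ∀ v ∈ (w 1).support, v ∉ ω := fun v hv => by simpa using (hw 1).2.2.2.2 v hv
  have hcolF' : ∀ v ∈ (w 3).support, v ∉ ω := fun v hv => by simpa using (hw 3).2.2.2.2 v hv
  have hy0 : y 0 ∈ hexSide R 0 := (hw 0).2.1
  have hy1 : y 1 ∈ hexSide R 1 := (hw 1).2.1
  have hy2 : y 2 ∈ hexSide R 3 := (hw 2).2.1
  have hy3 : y 3 ∈ hexSide R 4 := (hw 3).2.1
  have hballR : ∀ {v : Site 2}, v ∈ triAnn r R → v ∈ (↑(triBall R) : Set (Site 2)) :=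
    fun hv => Finset.mem_coe.2 (mem_triBall_iff.2 (mem_triAnn.1 hv).2)
  refine ⟨x, y, w, fun j => ⟨(hw j).1, Finset.mem_coe.1 (hexSide_subset_triSphere R _ (hw j).2.1),
    (hw j).2.2⟩, hdisj, ?_, ?_⟩
  · -- no open path of the annulus joins `w 0` to `w 2`
    intro u hu v hv hp
    set B : Set (Site 2) := triAnn r R ∩ ω with hB
    have hBr : ∀ z ∈ B, (r : ℤ) ≤ triNorm z := fun z hz => (mem_triAnn.1 hz.1).1
    -- the black path side 0 → u → v → side 3
    have p0 : PathIn triGraph ((↑(triBall R) : Set (Site 2)) ∩ B) (y 0) u :=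
      ((PathIn.of_walk_mem_support (w 0) (fun _ h => h) hu).2).symm.mono fun z hz =>
        ⟨hballR (hsuppAnn 0 z hz), hsuppAnn 0 z hz, hcolT z hz⟩
    have p2 : PathIn triGraph ((↑(triBall R) : Set (Site 2)) ∩ B) v (y 2) :=
      ((PathIn.of_walk_mem_support (w 2) (fun _ h => h) hv).2).mono fun z hz =>
        ⟨hballR (hsuppAnn 2 z hz), hsuppAnn 2 z hz, hcolT' z hz⟩
    have pm : PathIn triGraph ((↑(triBall R) : Set (Site 2)) ∩ B) u v :=
      hp.mono fun z hz => ⟨hballR hz.1, hz⟩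
    -- the white paths from the inner ends of the closed arms to the sides 1 and 4
    have q1 : PathIn triGraph ((↑(triBall R) : Set (Site 2)) \ B) (x 1) (y 1) :=
      ((PathIn.of_walk_mem_support (w 1) (fun _ h => h) (SimpleGraph.Walk.start_mem_support _)).2).mono fun z hz =>
        ⟨hballR (hsuppAnn 1 z hz), fun hzB => hcolF z hz hzB.2⟩
    have q3 : PathIn triGraph ((↑(triBall R) : Set (Site 2)) \ B) (x 3) (y 3) :=
      ((PathIn.of_walk_mem_support (w 3) (fun _ h => h) (SimpleGraph.Walk.start_mem_support _)).2).mono fun z hz =>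
        ⟨hballR (hsuppAnn 3 z hz), fun hzB => hcolF' z hz hzB.2⟩
    exact not_pathIn_sides_zero_three hr hrR hBr (hxn 1) hy1 (hxn 3) hy3 q1 q3 hy0 hy2
      ((p0.trans pm).trans p2)
  · -- no closed path of the annulus joins `w 1` to `w 3`: paint the hole black
    intro u hu v hv hp
    set B : Set (Site 2) := (triAnn r R ∩ ω) ∪ ↑(triBall (r - 1)) with hB
    -- the open arms with the hole form a black path from side 0 to side 3
    obtain ⟨h₀, hadj₀, hh₀⟩ := exists_adj_mem_triBall_sub_one hr (hxn 0)
    obtain ⟨h₂, hadj₂, hh₂⟩ := exists_adj_mem_triBall_sub_one hr (hxn 2)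
    have hhole : (↑(triBall (r - 1)) : Set (Site 2)) ⊆ (↑(triBall R) : Set (Site 2)) ∩ B := by
      intro z hz
      have hz' := mem_triBall_iff.1 (Finset.mem_coe.1 hz)
      push_cast [Nat.cast_sub hr] at hz'
      have hrR' : (r : ℤ) ≤ R := by exact_mod_cast hrR
      exact ⟨Finset.mem_coe.2 (mem_triBall_iff.2 (by omega)), Or.inr hz⟩
    have hmid : PathIn triGraph ((↑(triBall R) : Set (Site 2)) ∩ B) h₀ h₂ :=
      (pathIn_triBall hh₀ hh₂).mono hhole
    have p0 : PathIn triGraph ((↑(triBall R) : Set (Site 2)) ∩ B) (y 0) (x 0) :=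
      ((PathIn.of_walk_mem_support (w 0) (fun _ h => h) (SimpleGraph.Walk.start_mem_support _)).2).symm.mono fun z hz =>
        ⟨hballR (hsuppAnn 0 z hz), Or.inl ⟨hsuppAnn 0 z hz, hcolT z hz⟩⟩
    have p2 : PathIn triGraph ((↑(triBall R) : Set (Site 2)) ∩ B) (x 2) (y 2) :=
      ((PathIn.of_walk_mem_support (w 2) (fun _ h => h) (SimpleGraph.Walk.start_mem_support _)).2).mono fun z hz =>
        ⟨hballR (hsuppAnn 2 z hz), Or.inl ⟨hsuppAnn 2 z hz, hcolT' z hz⟩⟩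
    have pblack : PathIn triGraph ((↑(triBall R) : Set (Site 2)) ∩ B) (y 0) (y 2) :=
      ((p0.tail hadj₀ hmid.left_mem).trans hmid).trans
        ((PathIn.of_adj hmid.right_mem p2.left_mem hadj₂.symm).trans p2)
    -- the white path side 1 → u → v → side 4 avoids `B`
    have hwhite : ∀ {z : Site 2}, z ∈ triAnn r R → z ∉ ω → z ∈ (↑(triBall R) : Set (Site 2)) \ B := by
      intro z hz hzω
      refine ⟨hballR hz, ?_⟩
      rintro (⟨-, hzω'⟩ | hzh)
      · exact hzω hzω'
      · have h1 := mem_triBall_iff.1 (Finset.mem_coe.1 hzh)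
        have h2 := (mem_triAnn.1 hz).1
        push_cast [Nat.cast_sub hr] at h1
        omega
    have q1 : PathIn triGraph ((↑(triBall R) : Set (Site 2)) \ B) (y 1) u :=
      ((PathIn.of_walk_mem_support (w 1) (fun _ h => h) hu).2).symm.mono fun z hz => hwhite (hsuppAnn 1 z hz) (hcolF z hz)
    have q3 : PathIn triGraph ((↑(triBall R) : Set (Site 2)) \ B) v (y 3) :=
      ((PathIn.of_walk_mem_support (w 3) (fun _ h => h) hv).2).mono fun z hz => hwhite (hsuppAnn 3 z hz) (hcolF' z hz)
    have qm : PathIn triGraph ((↑(triBall R) : Set (Site 2)) \ B) u v :=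
      hp.mono fun z hz => hwhite hz.1 hz.2
    exact hexSides_interleaved_false hy0 hy2 hy1 hy3 pblack ((q1.trans qm).trans q3)

/-- `P_t(landedAltFourArm r R) ≤ π̂^alt_t(r, R)` (`1 ≤ r ≤ R`). [cite: Nolin2008, §4.1–4.2] -/
theorem real_landedAltFourArm_le_altFourArmProbAt (t : unitInterval) {r R : ℕ} (hr : 1 ≤ r)
    (hrR : r ≤ R) :
    (triSitePercolation t).real (landedAltFourArm r R) ≤ altFourArmProbAt t r R :=
  MeasureTheory.measureReal_mono (landedAltFourArm_subset_altFourArm hr hrR)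
    (MeasureTheory.measure_ne_top _ _)

end Literature.Probability.Percolation
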